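import Literature.NumberTheory.Sieve.FordMaynardFragmentationClaimPrep
import Literature.NumberTheory.Sieve.FordMaynardFragmentationForward
import HarnessLib

/-!
# Ford–Maynard, Theorem 6.4: symmetrising block products of the Linnik function

Everything here is PROVED. Seventh file towards Theorem 6.4 of K. Ford, J. Maynard,
*On the theory of prime producing sieves* (arXiv:2407.14368). In the converse direction
(6.3) ⇒ (TypeI-f) of §6.1 Ford–Maynard "replace the factor `𝓛_{1−γ}(v₁)⋯𝓛_{1−γ}(v_s)` by its
symmetric average" over the decompositions `z₁ ⊔ ⋯ ⊔ z_s = β` with prescribed sizes. We prove the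
resulting identity in the following integrated form (`claim`): for `Ψ ∈ 𝒮` bounded measurable,
`c`, a slice total `t`, `s ≥ 1` blocks and a dimension `a ≤ N`,

  `∑_{h ∈ [1,N]^s, |h| = a} ∫_{β ∈ Δ_a(t)} ∏_j 𝓛_c(β_j)/h_j! · Ψ(β) dβ
      = (1/a!) ∫_{β ∈ Δ_a(t)} 𝓛_c^{⋆s}([a])(β) · Ψ(β) dβ`,

`β_j` the consecutive blocks of `β` of sizes `h`, `𝓛^{⋆s}` the `s`-fold disjoint-union convolution
(the count of ORDERED decompositions into `s` subvectors, weighted by `∏ 𝓛`). The proof is by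
induction on `s`, two blocks at a time: split off the last block by the two-block Fubini formula,
apply the induction hypothesis — inside the integral over the total of the last block — to the
symmetric function `Ψ̃(v) = ∫ 𝓛_c(z)/b! Ψ(v,z) dz`, undo the Fubini formula, and identify the
result with the two-block symmetrisation (`sliceIntegral_symm_sconv`) of `𝓛^{⋆s} ⋆ 𝓛 = 𝓛^{⋆(s+1)}`.

## References

* K. Ford, J. Maynard, *On the theory of prime producing sieves*, arXiv:2407.14368 (2024), §6.1
  (proof of Theorem 6.4, (6.3) ⇒ (TypeI-f)). [FordMaynard2024PrimeSieves]
-/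

noncomputable section

open MeasureTheory Finset Literature.Combinatorics.Enumerative

namespace Literature.NumberTheory.Sieve.FordMaynard

/-! ### Block products of `𝓛`: measurability and bounds -/

/-- `s ≤ bsum s h` when all `h_j ≥ 1`. [folklore] -/
theorem le_bsum {s : ℕ} {h : Fin s → ℕ} (hh : ∀ j, 1 ≤ h j) : s ≤ bsum s h := by
  rw [bsum_eq_sum]
  calc s = ∑ _j : Fin s, 1 := by simp
    _ ≤ ∑ j, h j := Finset.sum_le_sum fun j _ => hh j

/-- A symmetric function on vectors absorbs casts of the dimension. [folklore] -/
theorem VecFn.IsSymmetric.apply_comp_cast {f : VecFn} (hf : f.IsSymmetric) {k k' : ℕ} (e : k = k')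
    (v : Fin k' → ℝ) : f k (v ∘ Fin.cast e) = f k' v :=
  hf.apply_comp_equiv (finCongr e) v

/-- Measurability of `β ↦ ∏_j 𝓛_c(β_j)/h_j!`. [folklore] -/
theorem measurable_linnikProd (c : ℝ) (s : ℕ) (h : Fin s → ℕ) :
    Measurable fun β : Fin (bsum s h) → ℝ => ∏ j, linnikFn c (fun i =>
      β (Fin.cast (bsum_eq_sum s h).symm (finSigmaFinEquiv (n := h) ⟨j, i⟩))) univ /
        ((h j).factorial : ℝ) :=
  Finset.measurable_prod _ fun _ _ => ((measurable_linnikFn c univ).comp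
    (measurable_pi_iff.2 fun _ => measurable_pi_apply _)).div_const _

/-- A bound for `∏_j 𝓛_c(β_j)/h_j!`: `∏_j h_j (2^{h_j})^{h_j}`. [folklore] -/
theorem abs_linnikProd_le (c : ℝ) (s : ℕ) (h : Fin s → ℕ) (β : Fin (bsum s h) → ℝ) :
    |∏ j, linnikFn c (fun i =>
      β (Fin.cast (bsum_eq_sum s h).symm (finSigmaFinEquiv (n := h) ⟨j, i⟩))) univ /
        ((h j).factorial : ℝ)| ≤ ∏ j, ((h j : ℝ) * (2 ^ h j) ^ h j) := by
  rw [Finset.abs_prod]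
  refine Finset.prod_le_prod (fun j _ => abs_nonneg _) fun j _ => ?_
  rw [abs_div, Nat.abs_cast]
  have h1 := abs_linnikFn_le c (fun i =>
    β (Fin.cast (bsum_eq_sum s h).symm (finSigmaFinEquiv (n := h) ⟨j, i⟩))) univ
  simp only [Fintype.card_fin] at h1
  have hfac : (1 : ℝ) ≤ (h j).factorial := by
    exact_mod_cast Nat.one_le_iff_ne_zero.2 (Nat.factorial_ne_zero _)
  calc |linnikFn c _ univ| / ((h j).factorial : ℝ) ≤ |linnikFn c (fun i =>
        β (Fin.cast (bsum_eq_sum s h).symm (finSigmaFinEquiv (n := h) ⟨j, i⟩))) univ| / 1 :=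
        div_le_div_of_nonneg_left (abs_nonneg _) one_pos hfac
    _ ≤ _ := by rw [div_one]; exact h1

section Claim

variable {c : ℝ} {N : ℕ} {Ψ : VecFn} {B : ℝ}

/-! ### Step A: split off the last block (two-block Fubini) -/

/-- Splitting off the last block `z` of `β = (v, z)`:
`∫_{Δ_{|h|}(t)} ∏_j 𝓛(β_j)/h_j! Ψ(β) = ∫_0^t ∫_{v ∈ Δ_{|init h|}(τ)} ∏_{j<s} 𝓛(v_j)/h_j! · Ψ̃(v) dτ`,
`Ψ̃(v) = ∫_{z ∈ Δ_{h_s}(t−τ)} 𝓛(z)/h_s! Ψ(v,z) dz`. [cite: FordMaynard2024PrimeSieves, §6.1 (proof of Theorem 6.4)] -/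
theorem linnikProd_split (c : ℝ) (hΨm : ∀ n, Measurable (Ψ n)) (hΨb : ∀ n v, |Ψ n v| ≤ B)
    {s : ℕ} (h : Fin (s + 1) → ℕ) (h1 : 1 ≤ bsum s (Fin.init h)) (h2 : 1 ≤ h (Fin.last s)) (t : ℝ) :
    sliceIntegral (bsum (s + 1) h) t (fun β => (∏ j, linnikFn c (fun i =>
        β (Fin.cast (bsum_eq_sum (s + 1) h).symm (finSigmaFinEquiv (n := h) ⟨j, i⟩))) univ /
          ((h j).factorial : ℝ)) * Ψ (bsum (s + 1) h) β) =
      ∫ τ in Set.Ioc 0 t, sliceIntegral (bsum s (Fin.init h)) τ (fun v =>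
        (∏ j, linnikFn c (fun i => v (Fin.cast (bsum_eq_sum s (Fin.init h)).symm
            (finSigmaFinEquiv (n := Fin.init h) ⟨j, i⟩))) univ / ((Fin.init h j).factorial : ℝ)) *
          sliceIntegral (h (Fin.last s)) (t - τ) (fun z => linnikFn c z univ / ((h (Fin.last s)).factorial : ℝ) *
            Ψ (bsum s (Fin.init h) + h (Fin.last s)) (Fin.append v z))) := by
  have hB0 : 0 ≤ B := (abs_nonneg _).trans (hΨb 0 Fin.elim0)
  have hGb : ∀ β : Fin (bsum (s + 1) h) → ℝ, |(∏ j, linnikFn c (fun i =>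
      β (Fin.cast (bsum_eq_sum (s + 1) h).symm (finSigmaFinEquiv (n := h) ⟨j, i⟩))) univ /
        ((h j).factorial : ℝ)) * Ψ (bsum (s + 1) h) β| ≤ (∏ j, ((h j : ℝ) * (2 ^ h j) ^ h j)) * B := by
    intro β
    rw [abs_mul]
    exact mul_le_mul (abs_linnikProd_le c (s + 1) h β) (hΨb _ _) (abs_nonneg _) (by positivity)
  refine (sliceIntegral_append' (n₁ := bsum s (Fin.init h)) (n₂ := h (Fin.last s)) h1 h2 t
    (fun β : Fin (bsum (s + 1) h) → ℝ => (∏ j, linnikFn c (fun i =>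
      β (Fin.cast (bsum_eq_sum (s + 1) h).symm (finSigmaFinEquiv (n := h) ⟨j, i⟩))) univ /
        ((h j).factorial : ℝ)) * Ψ (bsum (s + 1) h) β)
    ((measurable_linnikProd c (s + 1) h).mul (hΨm _)) (by positivity) hGb).trans ?_
  refine setIntegral_congr_fun measurableSet_Ioc fun τ _ => ?_
  congr 1
  funext v
  rw [← sliceIntegral_const_mul]
  congr 1
  funext z
  rw [linnikProd_peel c h (Fin.append v z)]
  simp only [Fin.append_left, Fin.append_right]
  have hΨeq : Ψ (bsum (s + 1) h) (Fin.append v z) = Ψ (bsum s (Fin.init h) + h (Fin.last s)) (Fin.append v z) := rfl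
  rw [hΨeq]
  ring

/-! ### Step B: integrability in the total of the last block -/

/-- The outer integrand of Step A is integrable on `(0, t]`. [folklore] -/
theorem integrableOn_linnikProd_psiAux (c : ℝ) (hΨm : ∀ n, Measurable (Ψ n))
    (hΨb : ∀ n v, |Ψ n v| ≤ B) (s : ℕ) (h' : Fin s → ℕ) (b : ℕ) {t : ℝ} (ht : 0 < t) :
    IntegrableOn (fun τ => sliceIntegral (bsum s h') τ (fun v =>
        (∏ j, linnikFn c (fun i => v (Fin.cast (bsum_eq_sum s h').symm
            (finSigmaFinEquiv (n := h') ⟨j, i⟩))) univ / ((h' j).factorial : ℝ)) *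
          sliceIntegral b (t - τ) (fun z => linnikFn c z univ / (b.factorial : ℝ) *
            Ψ (bsum s h' + b) (Fin.append v z)))) (Set.Ioc 0 t) := by
  have hB0 : 0 ≤ B := (abs_nonneg _).trans (hΨb 0 Fin.elim0)
  have hmeas : Measurable fun τ => sliceIntegral (bsum s h') τ (fun v =>
      (∏ j, linnikFn c (fun i => v (Fin.cast (bsum_eq_sum s h').symm
          (finSigmaFinEquiv (n := h') ⟨j, i⟩))) univ / ((h' j).factorial : ℝ)) *
        sliceIntegral b (t - τ) (fun z => linnikFn c z univ / (b.factorial : ℝ) *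
          Ψ (bsum s h' + b) (Fin.append v z))) := by
    refine measurable_sliceIntegral_param (X := ℝ) (bsum s h') (w := fun τ => τ) measurable_id ?_
    exact ((measurable_linnikProd c s h').comp measurable_snd).mul (measurable_psiAux_param hΨm c b t _)
  set R : ℝ := max t 1 with hR
  have hR1 : 1 ≤ R := le_max_right _ _
  refine Measure.integrableOn_of_bounded (M := (∏ j, ((h' j : ℝ) * (2 ^ h' j) ^ h' j)) *
      (b * (2 ^ b) ^ b / (b.factorial : ℝ) * B * R ^ b) * R ^ bsum s h')
    measure_Ioc_lt_top.ne hmeas.aestronglyMeasurable ?_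
  rw [ae_restrict_iff' measurableSet_Ioc]
  refine Filter.Eventually.of_forall fun τ hτ => ?_
  rw [Real.norm_eq_abs]
  refine abs_sliceIntegral_le_pow _ hR1 (hτ.2.trans (le_max_left _ _)) (by positivity) fun v => ?_
  rw [abs_mul]
  exact mul_le_mul (abs_linnikProd_le c s h' v)
    (abs_psiAux_le hΨb c b hR1 (by linarith [hτ.1, le_max_left t 1]) _ v) (abs_nonneg _) (by positivity)

/-! ### Step C: after the induction hypothesis, undo the Fubini formula -/

/-- Undoing the two-block Fubini formula and transporting to dimension `a`:
`∫_0^t ∫_{v ∈ Δ_{a−b}(τ)} 𝓛^{⋆s}(v) ∫_{z ∈ Δ_b(t−τ)} 𝓛(z)/b! Ψ(v,z) dτ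
 = (1/b!) ∫_{β ∈ Δ_a(t)} Ψ(β) 𝓛^{⋆s}_β({i < a−b}) 𝓛_β({i ≥ a−b}) dβ` (`1 ≤ b < a`).
[cite: FordMaynard2024PrimeSieves, §6.1 (proof of Theorem 6.4)] -/
theorem spow_psiAux_unsplit (c : ℝ) (hΨs : Ψ.IsSymmetric) (hΨm : ∀ n, Measurable (Ψ n))
    (hΨb : ∀ n v, |Ψ n v| ≤ B) (s : ℕ) {a b : ℕ} (hb1 : 1 ≤ b) (hba : b < a) (t : ℝ) :
    ∫ τ in Set.Ioc 0 t, sliceIntegral (a - b) τ (fun v => spow (linnikFn c v) s univ *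
        sliceIntegral b (t - τ) (fun z => linnikFn c z univ / (b.factorial : ℝ) *
          Ψ (a - b + b) (Fin.append v z))) =
      (1 / (b.factorial : ℝ)) * sliceIntegral a t (fun β => Ψ a β *
        (spow (linnikFn c β) s (univ.filter fun i : Fin a => (i : ℕ) < a - b) *
          linnikFn c β (univ \ univ.filter fun i : Fin a => (i : ℕ) < a - b))) := by
  have hB0 : 0 ≤ B := (abs_nonneg _).trans (hΨb 0 Fin.elim0)
  have e : a = a - b + b := (Nat.sub_add_cancel hba.le).symm
  -- the integrand in dimension `(a - b) + b`
  set G : (Fin (a - b + b) → ℝ) → ℝ := fun u => spow (linnikFn c (fun i => u (Fin.castAdd b i))) s univ *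
    (linnikFn c (fun i => u (Fin.natAdd (a - b) i)) univ / (b.factorial : ℝ) * Ψ (a - b + b) u) with hG
  have hGm : Measurable G := by
    refine ((measurable_spow_linnikFn c s univ).comp (measurable_pi_iff.2 fun i => measurable_pi_apply _)).mul
      ((((measurable_linnikFn c univ).comp (measurable_pi_iff.2 fun i => measurable_pi_apply _)).div_const _).mul
        (hΨm _))
  set Cst : ℝ := (2 ^ (a - b) * ((a - b : ℕ) * (2 ^ (a - b)) ^ (a - b))) ^ s *
    (b * (2 ^ b) ^ b / (b.factorial : ℝ) * B) with hCst
  have hGb : ∀ u, |G u| ≤ Cst := by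
    intro u
    simp only [hG, hCst]
    rw [abs_mul, abs_mul, abs_div, Nat.abs_cast]
    have h2 := abs_linnikFn_le c (fun i => u (Fin.natAdd (a - b) i)) univ
    simp only [Fintype.card_fin] at h2
    refine mul_le_mul (abs_spow_linnikFn_le c _ s univ) (mul_le_mul (div_le_div_of_nonneg_right h2
      (by positivity)) (hΨb _ _) (abs_nonneg _) (by positivity)) (by positivity) (by positivity)
  have hsplit := sliceIntegral_append' (n₁ := a - b) (n₂ := b) (by omega) hb1 t G hGm
    (by positivity) hGb
  have hinner : ∀ τ (v : Fin (a - b) → ℝ), sliceIntegral b (t - τ) (fun z => G (Fin.append v z)) =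
      spow (linnikFn c v) s univ * sliceIntegral b (t - τ) (fun z => linnikFn c z univ / (b.factorial : ℝ) *
        Ψ (a - b + b) (Fin.append v z)) := by
    intro τ v
    rw [← sliceIntegral_const_mul]
    congr 1
    funext z
    simp only [hG, append_castAdd_eq, append_natAdd_eq]
  simp only [hinner] at hsplit
  rw [← hsplit]
  -- transport `G` to dimension `a`
  rw [← sliceIntegral_const_mul,
    ← sliceIntegral_comp_cast e t (fun β => 1 / (b.factorial : ℝ) * (Ψ a β *
      (spow (linnikFn c β) s (univ.filter fun i : Fin a => (i : ℕ) < a - b) *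
        linnikFn c β (univ \ univ.filter fun i : Fin a => (i : ℕ) < a - b))))]
  congr 1
  funext u
  simp only [hG]
  rw [spow_linnikFn_castAdd, ← filter_lt_eq_map_castAddEmb, linnikFn_natAdd,
    ← sdiff_filter_lt_eq_map_natAddEmb, spow_linnikFn_comp_cast e, map_filter_lt_finCongr,
    linnikFn_comp_cast e, map_sdiff_filter_lt_finCongr, hΨs.apply_comp_cast e]
  ring

/-! ### Step D: the symmetrised side -/

/-- The symmetrised side in terms of the two-block terms:
`(1/a!) ∫ 𝓛^{⋆(s+1)} Ψ = ∑_{b=1}^{a−1} 1/((a−b)! b!) ∫ Ψ · 𝓛^{⋆s}({i<a−b}) 𝓛({i ≥ a−b})` (`s ≥ 1`).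
[cite: FordMaynard2024PrimeSieves, §6.1 (proof of Theorem 6.4)] -/
theorem spow_succ_symm_expand (c : ℝ) (hΨs : Ψ.IsSymmetric) (hΨm : ∀ n, Measurable (Ψ n))
    (hΨb : ∀ n v, |Ψ n v| ≤ B) {s : ℕ} (hs : 1 ≤ s) (a : ℕ) (t : ℝ) :
    (1 / (a.factorial : ℝ)) * sliceIntegral a t (fun v => spow (linnikFn c v) (s + 1) univ * Ψ a v) =
      ∑ b ∈ Finset.Ico 1 a, (1 / (((a - b).factorial : ℝ) * (b.factorial : ℝ))) *
        sliceIntegral a t (fun β => Ψ a β *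
          (spow (linnikFn c β) s (univ.filter fun i : Fin a => (i : ℕ) < a - b) *
            linnikFn c β (univ \ univ.filter fun i : Fin a => (i : ℕ) < a - b))) := by
  have hB0 : 0 ≤ B := (abs_nonneg _).trans (hΨb 0 Fin.elim0)
  -- two-block symmetrisation of `𝓛^{⋆s} ⋆ 𝓛`
  have hsym : sliceIntegral a t (fun v => spow (linnikFn c v) (s + 1) univ * Ψ a v) =
      ∑ a' ∈ Finset.range (a + 1), (a.choose a' : ℝ) * sliceIntegral a t (fun β => Ψ a β *
        (spow (linnikFn c β) s (univ.filter fun i : Fin a => (i : ℕ) < a') *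
          linnikFn c β (univ \ univ.filter fun i : Fin a => (i : ℕ) < a'))) := by
    have : (fun v : Fin a → ℝ => spow (linnikFn c v) (s + 1) univ * Ψ a v) =
        fun v => Ψ a v * sconv (spow (linnikFn c v) s) (linnikFn c v) univ := by
      funext v
      rw [spow_succ', mul_comm]
    rw [this]
    exact sliceIntegral_symm_sconv t (F := Ψ a) (hΨs a)
      (P := fun v S => spow (linnikFn c v) s S) (Q := fun v S => linnikFn c v S)
      (fun σ u S => spow_linnikFn_comp_perm σ c u s S) (fun σ u S => linnikFn_comp_perm σ c u S)
      (fun S S' => measurable_symmIntegrand (hΨm a) c s S S')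
      (fun S S' u => abs_symmIntegrand_le (fun β => hΨb a β) c s S S' u)
  rw [hsym, Finset.mul_sum, ← Finset.sum_range_reflect]
  simp only [Nat.add_sub_cancel]
  -- the terms `b = 0` and `b = a` vanish; the other coefficients are `1/((a-b)! b!)`
  have hIco : Finset.Ico 1 a ⊆ Finset.range (a + 1) := fun b hb => by
    simp only [Finset.mem_Ico] at hb
    exact Finset.mem_range.2 (by omega)
  have hvan : ∀ b ∈ Finset.range (a + 1), b ∉ Finset.Ico 1 a →
      1 / (a.factorial : ℝ) * (((a.choose (a - b) : ℕ) : ℝ) * sliceIntegral a t (fun β => Ψ a β *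
        (spow (linnikFn c β) s (univ.filter fun i : Fin a => (i : ℕ) < a - b) *
          linnikFn c β (univ \ univ.filter fun i : Fin a => (i : ℕ) < a - b)))) = 0 := by
    intro b hb hb'
    simp only [Finset.mem_range] at hb
    simp only [Finset.mem_Ico, not_and, not_lt] at hb'
    have hb0 : b = 0 ∨ b = a := by omega
    rcases hb0 with rfl | rfl
    · simp only [Nat.sub_zero]
      have : (fun β : Fin a → ℝ => Ψ a β * (spow (linnikFn c β) s (univ.filter fun i : Fin a => (i : ℕ) < a) *
          linnikFn c β (univ \ univ.filter fun i : Fin a => (i : ℕ) < a))) = fun _ => 0 := by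
        funext β
        have hfull : (univ.filter fun i : Fin a => (i : ℕ) < a) = univ := by
          ext i; simp
        rw [hfull, Finset.sdiff_self, linnikFn_empty, mul_zero, mul_zero]
      rw [this, sliceIntegral_zero, mul_zero, mul_zero]
    · simp only [Nat.sub_self]
      have : (fun β : Fin b → ℝ => Ψ b β * (spow (linnikFn c β) s (univ.filter fun i : Fin b => (i : ℕ) < 0) *
          linnikFn c β (univ \ univ.filter fun i : Fin b => (i : ℕ) < 0))) = fun _ => 0 := by
        funext β
        have hempty : (univ.filter fun i : Fin b => (i : ℕ) < 0) = ∅ := by ext i; simp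
        obtain ⟨s', rfl⟩ : ∃ s', s = s' + 1 := ⟨s - 1, by omega⟩
        rw [hempty, spow_succ_empty (linnikFn_empty c β), zero_mul, mul_zero]
      rw [this, sliceIntegral_zero, mul_zero, mul_zero]
  rw [← Finset.sum_subset hIco hvan]
  refine Finset.sum_congr rfl fun b hb => ?_
  simp only [Finset.mem_Ico] at hb
  have hcoef : 1 / (a.factorial : ℝ) * ((a.choose (a - b) : ℕ) : ℝ) =
      1 / (((a - b).factorial : ℝ) * (b.factorial : ℝ)) := by
    have h1 := choose_mul_factorial_div (a - b) b
    rw [Nat.sub_add_cancel hb.2.le] at h1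
    have hbf : (b.factorial : ℝ) ≠ 0 := by exact_mod_cast Nat.factorial_ne_zero b
    have habf : ((a - b).factorial : ℝ) ≠ 0 := by exact_mod_cast Nat.factorial_ne_zero _
    have haf : (a.factorial : ℝ) ≠ 0 := by exact_mod_cast Nat.factorial_ne_zero a
    field_simp
    field_simp at h1
    linarith [h1]
  rw [← mul_assoc, hcoef]

/-! ### Step E: regrouping the sum over block sizes by the size of the last block -/

/-- The sum over `h ∈ [1,N]^{s+1}` with `|h| = a` of a quantity depending on `(init h, h_s)`,
regrouped by the last size `b = h_s`: the initial sizes range over `h' ∈ [1,N]^s` with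
`|h'| = a − b` (for `b ≥ a` there are none, the sizes being `≥ 1`, `s ≥ 1`). [folklore] -/
theorem sum_filter_bsum_succ {s : ℕ} (hs : 1 ≤ s) (N a : ℕ) (F : (Fin s → ℕ) → ℕ → ℝ) :
    ∑ h ∈ (Fintype.piFinset fun _ : Fin (s + 1) => Finset.Icc 1 N).filter (fun h => bsum (s + 1) h = a),
        F (Fin.init h) (h (Fin.last s)) =
      ∑ b ∈ Finset.Icc 1 N, ∑ h' ∈ (Fintype.piFinset fun _ : Fin s => Finset.Icc 1 N).filter
        (fun h' => bsum s h' = a - b), if b < a then F h' b else 0 := by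
  rw [Finset.sum_filter]
  rw [show (∑ h ∈ Fintype.piFinset (fun _ : Fin (s + 1) => Finset.Icc 1 N),
      if bsum (s + 1) h = a then F (Fin.init h) (h (Fin.last s)) else 0) =
      ∑ h ∈ Fintype.piFinset (fun _ : Fin (s + 1) => Finset.Icc 1 N),
        (fun h' b => if bsum s h' + b = a then F h' b else 0) (Fin.init h) (h (Fin.last s)) from rfl,
    sum_piFinset_init_last (Finset.Icc 1 N) (fun h' b => if bsum s h' + b = a then F h' b else 0),
    Finset.sum_comm]
  refine Finset.sum_congr rfl fun b hb => ?_
  rw [Finset.sum_filter]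
  refine Finset.sum_congr rfl fun h' hh' => ?_
  have hle : s ≤ bsum s h' := le_bsum fun j => (Finset.mem_Icc.1 (Fintype.mem_piFinset.1 hh' j)).1
  by_cases hba : b < a
  · rw [if_pos hba]
    have : (bsum s h' + b = a) ↔ (bsum s h' = a - b) := by omega
    simp only [this]
  · rw [if_neg hba]
    have h1 : ¬ (bsum s h' + b = a) := by omega
    have h2 : ¬ (bsum s h' = a - b) := by omega
    rw [if_neg h1, if_neg h2]

/-! ### The claim -/

/-- **Symmetrisation of block products of `𝓛` (integrated form).** For `Ψ ∈ 𝒮` bounded and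
measurable, `s ≥ 1` and `a ≤ N`:
`∑_{h ∈ [1,N]^s, |h| = a} ∫_{Δ_{|h|}(t)} ∏_j 𝓛_c(β_j)/h_j! · Ψ(β) dβ
  = (1/a!) ∫_{Δ_a(t)} 𝓛_c^{⋆s}([a])(β) Ψ(β) dβ`.
This is the step "we may replace `𝓛(v₁)⋯𝓛(v_s)` by its symmetric average over the decompositions
`z₁ ⊔ ⋯ ⊔ z_s = β`, `|z_i| = h_i`" of §6.1, summed over the block sizes (the number of ordered
decompositions with sizes `h` being `a!/∏ h_j!`). [cite: FordMaynard2024PrimeSieves, §6.1 (proof of Theorem 6.4, (6.3) ⇒ (TypeI-f))] -/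
theorem claim (c : ℝ) (N : ℕ) :
    ∀ (s : ℕ), 1 ≤ s → ∀ (Ψ : VecFn), Ψ.IsSymmetric → (∀ n, Measurable (Ψ n)) →
      ∀ (B : ℝ), (∀ n v, |Ψ n v| ≤ B) → ∀ (t : ℝ) (a : ℕ), a ≤ N →
      ∑ h ∈ (Fintype.piFinset fun _ : Fin s => Finset.Icc 1 N).filter (fun h => bsum s h = a),
          sliceIntegral (bsum s h) t (fun β => (∏ j, linnikFn c (fun i =>
            β (Fin.cast (bsum_eq_sum s h).symm (finSigmaFinEquiv (n := h) ⟨j, i⟩))) univ /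
              ((h j).factorial : ℝ)) * Ψ (bsum s h) β) =
        (1 / (a.factorial : ℝ)) * sliceIntegral a t (fun v => spow (linnikFn c v) s univ * Ψ a v) := by
  intro s hs
  induction s, hs using Nat.le_induction with
  | base =>
    intro Ψ hΨs hΨm B hΨb t a ha
    by_cases ha0 : a = 0
    · subst ha0
      rw [Finset.sum_eq_zero, show sliceIntegral 0 t (fun v => spow (linnikFn c v) 1 univ * Ψ 0 v) = 0
        from rfl, mul_zero]
      intro h hh
      exfalso
      simp only [Finset.mem_filter, Fintype.mem_piFinset, Finset.mem_Icc] at hh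
      have h1 := (hh.1 (Fin.last 0)).1
      have h2 : bsum 0 (Fin.init h) + h (Fin.last 0) = 0 := hh.2
      have h3 : bsum 0 (Fin.init h) = 0 := rfl
      omega
    have ha1 : 1 ≤ a := Nat.one_le_iff_ne_zero.2 ha0
    -- the only `h` is the constant `a`
    set h₀ : Fin 1 → ℕ := fun _ => a with hh₀
    have hmem : h₀ ∈ (Fintype.piFinset fun _ : Fin 1 => Finset.Icc 1 N).filter (fun h => bsum 1 h = a) := by
      simp only [Finset.mem_filter, Fintype.mem_piFinset, Finset.mem_Icc]
      exact ⟨fun _ => ⟨ha1, ha⟩, Nat.zero_add a⟩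
    rw [Finset.sum_eq_single_of_mem h₀ hmem]
    swap
    · intro h hh hne
      exfalso
      apply hne
      funext j
      simp only [Finset.mem_filter, Fintype.mem_piFinset, Finset.mem_Icc] at hh
      have hj : j = Fin.last 0 := Subsingleton.elim _ _
      subst hj
      have h2 : bsum 0 (Fin.init h) + h (Fin.last 0) = a := hh.2
      have h3 : bsum 0 (Fin.init h) = 0 := rfl
      show h (Fin.last 0) = a
      omega
    -- transport from dimension `bsum 1 h₀ = 0 + a` to `a`
    have e : a = bsum 1 h₀ := (Nat.zero_add a).symm
    rw [← sliceIntegral_const_mul, ← sliceIntegral_comp_cast e t]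
    congr 1
    funext β
    rw [Fin.prod_univ_castSucc]
    simp only [Finset.univ_eq_empty, Finset.prod_empty, one_mul, spow_succ, spow_zero, sconv_sdelta]
    have hblock : (fun i : Fin (h₀ (Fin.last 0)) =>
        β (Fin.cast (bsum_eq_sum 1 h₀).symm (finSigmaFinEquiv (n := h₀) ⟨Fin.last 0, i⟩))) =
        β ∘ Fin.cast e := by
      funext i
      rw [apply_cast_finSigmaFinEquiv_last' h₀ β i]
      refine congrArg β (Fin.ext ?_)
      simp only [Fin.val_natAdd, Fin.val_cast]
      exact Nat.zero_add _
    rw [hblock, linnikFn_comp_cast e, Finset.map_univ_equiv, hΨs.apply_comp_cast e]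
    show linnikFn c β univ / ((a.factorial : ℝ)) * Ψ (bsum 1 h₀) β =
      1 / ((a.factorial : ℝ)) * (linnikFn c β univ * Ψ (bsum 1 h₀) β)
    ring
  | succ s hs IH =>
    intro Ψ hΨs hΨm B hΨb t a ha
    have hB0 : 0 ≤ B := (abs_nonneg _).trans (hΨb 0 Fin.elim0)
    -- the case `a = 0`: both sides vanish
    by_cases ha0 : a = 0
    · subst ha0
      rw [Finset.sum_eq_zero, show sliceIntegral 0 t (fun v => spow (linnikFn c v) (s + 1) univ * Ψ 0 v) = 0
        from rfl, mul_zero]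
      intro h hh
      exfalso
      simp only [Finset.mem_filter, Fintype.mem_piFinset, Finset.mem_Icc] at hh
      have h1 := (hh.1 (Fin.last s)).1
      have h2 : bsum s (Fin.init h) + h (Fin.last s) = 0 := hh.2
      omega
    -- the case `t ≤ 0`: both sides vanish
    by_cases ht : t ≤ 0
    · rw [sliceIntegral_eq_zero_of_nonpos _ ht, mul_zero]
      refine Finset.sum_eq_zero fun h _ => sliceIntegral_eq_zero_of_nonpos _ ht _
    push Not at ht
    -- Step A: split off the last block in every term
    have hA : ∀ h ∈ (Fintype.piFinset fun _ : Fin (s + 1) => Finset.Icc 1 N).filter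
        (fun h => bsum (s + 1) h = a),
        sliceIntegral (bsum (s + 1) h) t (fun β => (∏ j, linnikFn c (fun i =>
          β (Fin.cast (bsum_eq_sum (s + 1) h).symm (finSigmaFinEquiv (n := h) ⟨j, i⟩))) univ /
            ((h j).factorial : ℝ)) * Ψ (bsum (s + 1) h) β) =
        ∫ τ in Set.Ioc 0 t, sliceIntegral (bsum s (Fin.init h)) τ (fun v =>
          (∏ j, linnikFn c (fun i => v (Fin.cast (bsum_eq_sum s (Fin.init h)).symm
              (finSigmaFinEquiv (n := Fin.init h) ⟨j, i⟩))) univ / ((Fin.init h j).factorial : ℝ)) *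
            sliceIntegral (h (Fin.last s)) (t - τ) (fun z => linnikFn c z univ /
              ((h (Fin.last s)).factorial : ℝ) * Ψ (bsum s (Fin.init h) + h (Fin.last s)) (Fin.append v z))) := by
      intro h hh
      simp only [Finset.mem_filter, Fintype.mem_piFinset, Finset.mem_Icc] at hh
      exact linnikProd_split c hΨm hΨb h
        (hs.trans (le_bsum fun j => (hh.1 (Fin.castSucc j)).1)) (hh.1 (Fin.last s)).1 t
    rw [Finset.sum_congr rfl hA]
    -- Step E: regroup by the size `b` of the last block
    rw [sum_filter_bsum_succ hs N a (fun h' b => ∫ τ in Set.Ioc 0 t, sliceIntegral (bsum s h') τ (fun v =>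
      (∏ j, linnikFn c (fun i => v (Fin.cast (bsum_eq_sum s h').symm
          (finSigmaFinEquiv (n := h') ⟨j, i⟩))) univ / ((h' j).factorial : ℝ)) *
        sliceIntegral b (t - τ) (fun z => linnikFn c z univ / (b.factorial : ℝ) *
          Ψ (bsum s h' + b) (Fin.append v z))))]
    -- Step D on the right
    rw [spow_succ_symm_expand c hΨs hΨm hΨb hs a t]
    -- compare the sums over `b`: both are supported on `1 ≤ b < a`
    have hsub : Finset.Ico 1 a ⊆ Finset.Icc 1 N := fun b hb => by
      simp only [Finset.mem_Ico] at hb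
      exact Finset.mem_Icc.2 ⟨hb.1, by omega⟩
    have hzero : ∀ b ∈ Finset.Icc 1 N, b ∉ Finset.Ico 1 a →
        (∑ h' ∈ (Fintype.piFinset fun _ : Fin s => Finset.Icc 1 N).filter (fun h' => bsum s h' = a - b),
          if b < a then ∫ τ in Set.Ioc 0 t, sliceIntegral (bsum s h') τ (fun v =>
            (∏ j, linnikFn c (fun i => v (Fin.cast (bsum_eq_sum s h').symm
                (finSigmaFinEquiv (n := h') ⟨j, i⟩))) univ / ((h' j).factorial : ℝ)) *
              sliceIntegral b (t - τ) (fun z => linnikFn c z univ / (b.factorial : ℝ) *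
                Ψ (bsum s h' + b) (Fin.append v z))) else 0) = 0 := by
      intro b hb hb'
      refine Finset.sum_eq_zero fun h' _ => ?_
      simp only [Finset.mem_Icc] at hb
      simp only [Finset.mem_Ico, not_and, not_lt] at hb'
      rw [if_neg (by have := hb' hb.1; omega)]
    rw [← Finset.sum_subset hsub hzero]
    refine Finset.sum_congr rfl fun b hb => ?_
    simp only [Finset.mem_Ico] at hb
    have hba : b < a := hb.2
    simp only [if_pos hba]
    -- Step B: interchange the finite sum over `h'` with the integral over `τ`
    rw [← integral_finsetSum _ (fun h' _ => integrableOn_linnikProd_psiAux c hΨm hΨb s h' b ht)]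
    -- the induction hypothesis, for every `τ`, applied to `Ψ̃`
    have hIH : ∀ τ ∈ Set.Ioc (0 : ℝ) t,
        ∑ h' ∈ (Fintype.piFinset fun _ : Fin s => Finset.Icc 1 N).filter (fun h' => bsum s h' = a - b),
          sliceIntegral (bsum s h') τ (fun v =>
            (∏ j, linnikFn c (fun i => v (Fin.cast (bsum_eq_sum s h').symm
                (finSigmaFinEquiv (n := h') ⟨j, i⟩))) univ / ((h' j).factorial : ℝ)) *
              sliceIntegral b (t - τ) (fun z => linnikFn c z univ / (b.factorial : ℝ) *
                Ψ (bsum s h' + b) (Fin.append v z))) =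
        (1 / ((a - b).factorial : ℝ)) * sliceIntegral (a - b) τ (fun v => spow (linnikFn c v) s univ *
          sliceIntegral b (t - τ) (fun z => linnikFn c z univ / (b.factorial : ℝ) *
            Ψ (a - b + b) (Fin.append v z))) := by
      intro τ _
      exact IH (fun n v => sliceIntegral b (t - τ) (fun z => linnikFn c z univ / (b.factorial : ℝ) *
          Ψ (n + b) (Fin.append v z))) (psiAux_symm hΨs c b (t - τ)) (measurable_psiAux hΨm c b (t - τ))
        _ (abs_psiAux_le hΨb c b (le_max_right (t - τ) 1) (le_max_left _ _)) τ (a - b) (by omega)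
    rw [setIntegral_congr_fun measurableSet_Ioc hIH, integral_const_mul]
    -- Step C: undo the Fubini formula
    rw [spow_psiAux_unsplit c hΨs hΨm hΨb s hb.1 hba t]
    have hbf : (b.factorial : ℝ) ≠ 0 := by exact_mod_cast Nat.factorial_ne_zero b
    have habf : ((a - b).factorial : ℝ) ≠ 0 := by exact_mod_cast Nat.factorial_ne_zero _
    rw [← mul_assoc]
    congr 1
    field_simp

end Claim

end Literature.NumberTheory.Sieve.FordMaynard
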